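import Summits.NavierStokesRegularity.NavierStokesRegularity.Theorems.LevelSetModerationHighSpeedPressureWorkModeratedSlice

/-!
# Route LevelSetModeration — `HighSpeedPressureWork`: the moderated split of the level-set pairing

Support file for item stmt-NavierStokesRegularity-18149; proves the registered stub `stub_moderatedSplit`
of line `Sketch` (comoving head ceiling). For a `C¹` divergence-free field `v` on `ℝ³` with bounded
`A = {c < |v|}` (`c > 0`), a continuous `q`, a frame `U` and a level `k` with the head ceiling
`H_U := q + |v - U|²/2 ≤ k` on `A`:

  `∫ 1_A κ q ≤ ∫ 1_A (c/|v|²) (-D|v|(v))₊ (k - H_U) + c |U| ∫ 1_A ‖D|v|‖`,   `κ = (c/|v|²) D|v|(v)`.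

Write `q = (H_U - k) + (k - |U|²/2 - |v|²/2) + ⟨v, U⟩`: the middle term is a continuous function of
the speed, removed by the landed `ModerationIdentity`; on `A`, `κ (H_U - k) ≤ (c/|v|²)(-D|v|(v))₊ (k - H_U)`
(`H_U - k ≤ 0`) and `κ ⟨v, U⟩ ≤ c |U| ‖D|v|‖` (`|D|v|(v)| ≤ ‖D|v|‖ |v|`, `|⟨v,U⟩| ≤ |v| |U|`).
-/

noncomputable section

-- single-conjunct summit: `Summit.<Summit>.<Problem>` repeats the name by the D-0017 layout
set_option linter.dupNamespace false

namespace Summit.NavierStokesRegularity.NavierStokesRegularity.Theorems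

open MeasureTheory Set Filter Topology
open scoped RealInnerProductSpace
open Literature.Analysis.FluidPDE

/-- `a b ≤ (-a)₊ (-b)` for `b ≤ 0`. [folklore] -/
theorem levelSetModeration_mul_le_negPart_mul {a b : ℝ} (hb : b ≤ 0) :
    a * b ≤ max (-a) 0 * (-b) := by
  rcases le_or_gt 0 a with ha | ha
  · calc a * b ≤ 0 := mul_nonpos_of_nonneg_of_nonpos ha hb
      _ ≤ max (-a) 0 * (-b) := mul_nonneg (le_max_right _ _) (by linarith)
  · rw [max_eq_left (by linarith)]
    linarith [mul_comm a b]

/-- **The moderated split** (registered stub `stub_moderatedSplit` of the crux item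
stmt-NavierStokesRegularity-18149, line `Sketch`): see the module docstring. [folklore] -/
theorem stub_moderatedSplit :
    ∀ (v : EuclideanSpace ℝ (Fin 3) → EuclideanSpace ℝ (Fin 3)) (q : EuclideanSpace ℝ (Fin 3) → ℝ) (c : ℝ) (U : EuclideanSpace ℝ (Fin 3)) (k : ℝ), 0 < c → ContDiff ℝ 1 v → Continuous q → Literature.Analysis.FluidPDE.VectorCalculus.IsDivFree v → Bornology.IsBounded {x | c < ‖v x‖} → (∀ x, c < ‖v x‖ → q x + ‖v x - U‖ ^ 2 / 2 ≤ k) → (∫ x, Set.indicator {x | c < ‖v x‖} (fun x => c / ‖v x‖ ^ 2 * (fderiv ℝ (fun y => ‖v y‖) x (v x)) * q x) x) ≤ (∫ x, Set.indicator {x | c < ‖v x‖} (fun x => c / ‖v x‖ ^ 2 * max (-(fderiv ℝ (fun y => ‖v y‖) x (v x))) 0 * (k - (q x + ‖v x - U‖ ^ 2 / 2))) x) + c * ‖U‖ * ∫ x, Set.indicator {x | c < ‖v x‖} (fun x => ‖fderiv ℝ (fun y => ‖v y‖) x‖) x := by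
  intro v q c U k hc hv hq hdiv hbdd hceil
  set A : Set (EuclideanSpace ℝ (Fin 3)) := {x | c < ‖v x‖} with hA
  set κ : EuclideanSpace ℝ (Fin 3) → ℝ :=
    fun x => c / ‖v x‖ ^ 2 * fderiv ℝ (fun y => ‖v y‖) x (v x) with hκ
  set H : EuclideanSpace ℝ (Fin 3) → ℝ := fun x => q x + ‖v x - U‖ ^ 2 / 2 with hH
  set g : ℝ → ℝ := fun s => k - ‖U‖ ^ 2 / 2 - s ^ 2 / 2 with hg
  have hvc : Continuous v := hv.continuous
  have hg_cont : Continuous g := by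
    show Continuous fun s : ℝ => k - ‖U‖ ^ 2 / 2 - s ^ 2 / 2
    fun_prop
  have hH_cont : Continuous H := by
    show Continuous fun x => q x + ‖v x - U‖ ^ 2 / 2
    fun_prop
  -- continuity at points of `{v ≠ 0}`
  have hDn : ∀ x, v x ≠ 0 → ContinuousAt (fun y => fderiv ℝ (fun z => ‖v z‖) y (v y)) x :=
    fun x hx => (levelSetModeration_continuousAt_fderiv_norm hv hx).clm_apply hvc.continuousAt
  have hκ_cont : ∀ x, v x ≠ 0 → ContinuousAt κ x := by
    intro x hx
    have h2 : ContinuousAt (fun y => c / ‖v y‖ ^ 2) x :=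
      continuousAt_const.div (hvc.norm.pow 2).continuousAt (pow_ne_zero 2 (norm_ne_zero_iff.2 hx))
    exact h2.mul (hDn x hx)
  -- the algebraic split of `q`
  have hsplit : ∀ x, q x = (H x - k) + g ‖v x‖ + ⟪v x, U⟫ := by
    intro x
    show q x = (q x + ‖v x - U‖ ^ 2 / 2 - k) + (k - ‖U‖ ^ 2 / 2 - ‖v x‖ ^ 2 / 2) + ⟪v x, U⟫
    rw [norm_sub_sq_real]
    ring
  -- the three integrable pieces
  have hI1 : Integrable (A.indicator fun x => κ x * (H x - k)) volume :=
    levelSetModeration_integrable_indicator_superlevel hc hv hbdd fun x hx =>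
      (hκ_cont x hx).mul (hH_cont.continuousAt.sub continuousAt_const)
  have hI2 : Integrable (A.indicator fun x => κ x * g ‖v x‖) volume :=
    levelSetModeration_integrable_indicator_superlevel hc hv hbdd fun x hx =>
      (hκ_cont x hx).mul (hg_cont.comp hvc.norm).continuousAt
  have hI3 : Integrable (A.indicator fun x => κ x * ⟪v x, U⟫) volume :=
    levelSetModeration_integrable_indicator_superlevel hc hv hbdd fun x hx =>
      (hκ_cont x hx).mul (hvc.continuousAt.inner continuousAt_const)
  -- rewrite the left-hand side
  have hLHS : (A.indicator fun x => c / ‖v x‖ ^ 2 * (fderiv ℝ (fun y => ‖v y‖) x (v x)) * q x) =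
      fun x => A.indicator (fun x => κ x * (H x - k)) x + A.indicator (fun x => κ x * g ‖v x‖) x +
        A.indicator (fun x => κ x * ⟪v x, U⟫) x := by
    funext x
    by_cases hx : x ∈ A
    · simp only [indicator_of_mem hx, hκ]
      rw [hsplit x]
      ring
    · simp only [indicator_of_notMem hx, add_zero]
  -- the moderator piece vanishes
  have hmod : ∫ x, A.indicator (fun x => κ x * g ‖v x‖) x = 0 := by
    have h := levelSetModeration_moderationIdentity_proof v g c hc hv hdiv hg_cont hbdd
    rw [← h]
    refine integral_congr_ae (Eventually.of_forall fun x => ?_)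
    by_cases hx : x ∈ A
    · rw [indicator_of_mem hx, indicator_of_mem hx, hκ]
      ring
    · rw [indicator_of_notMem hx, indicator_of_notMem hx]
  -- the deficit piece
  have hR1_int : Integrable (A.indicator fun x => c / ‖v x‖ ^ 2 *
      max (-(fderiv ℝ (fun y => ‖v y‖) x (v x))) 0 * (k - (q x + ‖v x - U‖ ^ 2 / 2))) volume := by
    refine levelSetModeration_integrable_indicator_superlevel hc hv hbdd fun x hx => ?_
    have h2 : ContinuousAt (fun y => c / ‖v y‖ ^ 2) x :=
      continuousAt_const.div (hvc.norm.pow 2).continuousAt (pow_ne_zero 2 (norm_ne_zero_iff.2 hx))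
    exact (h2.mul ((hDn x hx).neg.max continuousAt_const)).mul
      (continuousAt_const.sub hH_cont.continuousAt)
  have hle1 : ∫ x, A.indicator (fun x => κ x * (H x - k)) x ≤
      ∫ x, A.indicator (fun x => c / ‖v x‖ ^ 2 *
        max (-(fderiv ℝ (fun y => ‖v y‖) x (v x))) 0 * (k - (q x + ‖v x - U‖ ^ 2 / 2))) x := by
    refine integral_mono hI1 hR1_int fun x => ?_
    by_cases hx : x ∈ A
    · rw [indicator_of_mem hx, indicator_of_mem hx, hκ]
      have hx' : c < ‖v x‖ := hx
      have hb : H x - k ≤ 0 := sub_nonpos.2 (hceil x hx')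
      have hcoef : 0 ≤ c / ‖v x‖ ^ 2 := by positivity
      have key := levelSetModeration_mul_le_negPart_mul (a := fderiv ℝ (fun y => ‖v y‖) x (v x)) hb
      have hkH : -(H x - k) = k - (q x + ‖v x - U‖ ^ 2 / 2) := by rw [hH]; ring
      rw [hkH] at key
      calc c / ‖v x‖ ^ 2 * fderiv ℝ (fun y => ‖v y‖) x (v x) * (H x - k)
          = c / ‖v x‖ ^ 2 * (fderiv ℝ (fun y => ‖v y‖) x (v x) * (H x - k)) := by ring
        _ ≤ c / ‖v x‖ ^ 2 * (max (-(fderiv ℝ (fun y => ‖v y‖) x (v x))) 0 *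
              (k - (q x + ‖v x - U‖ ^ 2 / 2))) := mul_le_mul_of_nonneg_left key hcoef
        _ = _ := by ring
    · rw [indicator_of_notMem hx, indicator_of_notMem hx]
  -- the Galilean-cost piece
  have hR3_int : Integrable (A.indicator fun x => ‖fderiv ℝ (fun y => ‖v y‖) x‖) volume :=
    levelSetModeration_integrable_indicator_superlevel hc hv hbdd fun x hx =>
      (levelSetModeration_continuousAt_fderiv_norm hv hx).norm
  have hle3 : ∫ x, A.indicator (fun x => κ x * ⟪v x, U⟫) x ≤
      c * ‖U‖ * ∫ x, A.indicator (fun x => ‖fderiv ℝ (fun y => ‖v y‖) x‖) x := by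
    rw [← integral_const_mul]
    refine integral_mono hI3 (hR3_int.const_mul _) fun x => ?_
    by_cases hx : x ∈ A
    · rw [indicator_of_mem hx, indicator_of_mem hx]
      have hx' : c < ‖v x‖ := hx
      have hv0 : 0 < ‖v x‖ := hc.trans hx'
      have h1 : |κ x| ≤ ‖fderiv ℝ (fun y => ‖v y‖) x‖ / ‖v x‖ * c := by
        rw [hκ]
        show |c / ‖v x‖ ^ 2 * fderiv ℝ (fun y => ‖v y‖) x (v x)| ≤ _
        rw [abs_mul, abs_of_nonneg (by positivity : (0 : ℝ) ≤ c / ‖v x‖ ^ 2)]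
        have h := ContinuousLinearMap.le_opNorm (fderiv ℝ (fun y => ‖v y‖) x) (v x)
        rw [Real.norm_eq_abs] at h
        calc c / ‖v x‖ ^ 2 * |fderiv ℝ (fun y => ‖v y‖) x (v x)|
            ≤ c / ‖v x‖ ^ 2 * (‖fderiv ℝ (fun y => ‖v y‖) x‖ * ‖v x‖) := by gcongr
          _ = ‖fderiv ℝ (fun y => ‖v y‖) x‖ / ‖v x‖ * c := by field_simp
      have h2 : |⟪v x, U⟫| ≤ ‖v x‖ * ‖U‖ := abs_real_inner_le_norm _ _
      calc κ x * ⟪v x, U⟫ ≤ |κ x * ⟪v x, U⟫| := le_abs_self _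
        _ = |κ x| * |⟪v x, U⟫| := abs_mul _ _
        _ ≤ (‖fderiv ℝ (fun y => ‖v y‖) x‖ / ‖v x‖ * c) * (‖v x‖ * ‖U‖) :=
            mul_le_mul h1 h2 (abs_nonneg _) (by positivity)
        _ = c * ‖U‖ * ‖fderiv ℝ (fun y => ‖v y‖) x‖ := by field_simp
    · rw [indicator_of_notMem hx, indicator_of_notMem hx, mul_zero]
  -- assemble
  have hsum : (∫ x, (A.indicator (fun x => κ x * (H x - k)) x + A.indicator (fun x => κ x * g ‖v x‖) x +
      A.indicator (fun x => κ x * ⟪v x, U⟫) x)) =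
      (∫ x, A.indicator (fun x => κ x * (H x - k)) x) + 0 +
        ∫ x, A.indicator (fun x => κ x * ⟪v x, U⟫) x := by
    rw [integral_add, integral_add hI1 hI2, hmod]
    · exact hI1.add hI2
    · exact hI3
  rw [hLHS]
  show (∫ x, (A.indicator (fun x => κ x * (H x - k)) x + A.indicator (fun x => κ x * g ‖v x‖) x +
      A.indicator (fun x => κ x * ⟪v x, U⟫) x)) ≤ _
  rw [hsum, add_zero]
  exact add_le_add hle1 hle3

end Summit.NavierStokesRegularity.NavierStokesRegularity.Theorems
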